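import Summits.HodgeConjecture.HodgeConjecture.Theorems.K2E1bDSClsOfRecord         -- ★ p856729 (Q9c): `dsCellRep`, `dsClsOfRecord(_of_regular)`, `dsCarriersOfRecord(_cls)` (over ★ #23 `K2E1bCarriersOfRecord`, ★ U8-3)
import Literature.RepresentationTheory.Kovacevic2021.SU21GaugeExistence             -- ★ `levelGauge(_step)`, `gaugeC_of_gaugeB`, `gaugeD_of_gaugeA`, `nonempty_equiv_of_products_eq` (+ ★ `SU21GaugeEquivalence`: `gaugeMap`, `gaugeEquiv`, `gaugeMap_lie`)
import Literature.RepresentationTheory.Kovacevic2021.SU21CohomologicalClassification  -- ★ `forall_reach_of_isIrreducible`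
import HarnessLib

/-!
# K2 ∕ E1b unit U8, brick 8b-γ `K2E1bDSRecordRecognition`: «RECOGNITION ⇒ CLASS EQUALITY» — a Kovačević datum with the `K`-types and the invariant
# products of a record cell `dsCellDatum j a b c` has the `(𝔤,K)`-CLASS OF RECORD `dsClsOfRecord a b c j`

HCML Track B «K2-LIT», cell `hodgecm-mathlib`, crux H413 = stmt-HodgeConjecture-24833 (supports-only helper; closes nothing by itself).  Brick **8b-γ** of the
TABLE `Lines/K2_E1b_GKCohomologyU21_U8_ArchPacketSigns.md` ED. 8 §2d (K2E1b-plan (g3): «same `S` + same products + strongly connected ⇒ `𝒟.V ≃ (dsCellDatum i a b c).V`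
(★ `nonempty_equiv_of_products_eq`), and a datum isomorphism commuting with the twists induces a `GKEquiv` of the records ⇒ `GKIrrClass.mk` equal»; offered to
K2E4-p10 (g2) 2026-09-04T02:39:24Z).  THEOREMS ONLY (the `GKEquiv` is built anonymously inside an `AreGKEquivalent` proof; no `def`, no `sorry`, no instance
declaration — one `attribute [local instance] LieRing.ofAssociativeRing`, the idiom of every Kovačević file —, no notation).

* §1 **`exists_gauge_of_products_eq`** — ★ `nonempty_equiv_of_products_eq` with the gauge EXPOSED: two strongly connected data with the same `K`-types, a common
  level-minimal vertex `x₀`, square-complete `K`-type set and the same invariant products `A D′`, `B C′` differ by a nowhere-zero GAUGE `g` on the four arrow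
  families (same proof: ★ `levelGauge_step`, ★ `gaugeC_of_gaugeB`, ★ `gaugeD_of_gaugeA`).
* §2 **FUNCTORIALITY OF THE RECORD under a gauge**: the gauge map `u^k_{n,m} ↦ g_{n,m} u^k_{n,m}` (★ `gaugeMap`) intertwines the twisted `K`-actions of record
  (`gaugeMap_ρKOfRecord` — `K` acts inside each `K`-type by the matrix ★ `kTypeMatTw e n m`, which does not see the datum, and the gauge is a `K`-type-wise scalar)
  and the central twists of record (`gaugeMap_σOfRecord` — ★ `gaugeMap_lie` plus the scalar `(e∕3)·tr`); hence **`areGKEquivalent_ofRecord_of_gauge`**.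
* §3 **`areGKEquivalent_ofRecord_of_products_eq`** — §1 + §2, at every central weight `e`.
* §4 the record cells are admissible frames (`dsCellDatum_frame`: a level-minimal vertex; `dsCellDatum_squareComplete`), and the HEAD
  **`mk_ofRecord_eq_dsClsOfRecord`**: at a regular parameter, a strongly connected datum `𝒟` with `𝒟.S = (dsCellDatum j a b c).S` and the same invariant products has
  `GKIrrClass.mk ⟨𝒟.V, ρKOfRecord 𝒟 e, σOfRecord 𝒟 e, _, _⟩ = dsClsOfRecord a b c j` (`e = centralOf a b c`); irreducible-datum form
  `mk_ofRecord_eq_dsClsOfRecord_of_isIrreducible` (★ `forall_reach_of_isIrreducible`); and the `UnitaryDualWith`-shaped corollary **`exists_mk_ofRecord_eq_cls`**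
  (`∃ i, … = dsCarriersOfRecord.cls a b c i`).

Sources: [Kovacevic2021] §3 Thm 1–2, Remark 3 (the `K`-types and the products determine the module up to the gauge `u ↦ g u`), Thm 3; [BorelWallach2000] 0 §2.5,
I §4.3, VI §4 4.7–4.8; [Rogawski1990] §12.3 pp. 176–178; [KnappVogan1995] Prop. 4.120.  HONEST LABEL: 8b-γ is one of the three bricks of 8b (`UnitaryDualWith`); it
closes nothing by itself; HC_CM is proved only modulo the 7 printed citations (2 remaining named inputs: hLiu418 = stmt-HodgeConjecture-24832, h413 =
stmt-HodgeConjecture-24833) until rung 0 closes.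
-/

set_option autoImplicit false
set_option linter.dupNamespace false

noncomputable section

open Literature.NumberTheory.Automorphic
open Literature.RepresentationTheory
open Literature.RepresentationTheory.KonnoKonno2007 Literature.RepresentationTheory.KonnoKonno2007.RealDualPair
open Literature.RepresentationTheory.Kovacevic2021 Literature.RepresentationTheory.Kovacevic2021.SU21Datum
open Summit.HodgeConjecture.HodgeConjecture.Cruxes.H413.F0P3bLocalAPacketsDefs
open Summit.HodgeConjecture.HodgeConjecture.Cruxes.H413.F0P3bKTypeIntegration (KIdx kvec kvec_of_pos)
open Summit.HodgeConjecture.HodgeConjecture.Cruxes.H413.K2E1bGKCohomologyU21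
open Summit.HodgeConjecture.HodgeConjecture.Cruxes.H413.K2E1bGKCohomologyU21.U8
open Summit.HodgeConjecture.HodgeConjecture.Cruxes.H413.K2E1bGKCohomologyU21.U8.LevelB
open Summit.HodgeConjecture.HodgeConjecture.Cruxes.H413.K2E1bKTypeTwistGK (kTypeRepTw kTypeEndTw kTypeImgTw kTypeMatTw kTypeEndTw_single)
open Summit.HodgeConjecture.HodgeConjecture.Cruxes.H413.K2E1bCarriersOfRecord
open Summit.HodgeConjecture.HodgeConjecture.Cruxes.H413.K2E1bDSCellData
open Summit.HodgeConjecture.HodgeConjecture.Cruxes.H413.K2E1bDSClsOfRecord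

namespace Summit.HodgeConjecture.HodgeConjecture.Cruxes.H413.K2E1bDSRecordRecognition

-- Mathlib idiom (as in ★ `SU21GaugeExistence`, ★ `K2E1bDSClsOfRecord`): `Module.End ℂ V` ∕ matrices as Lie rings by commutators.
attribute [local instance 100] LieRing.ofAssociativeRing

/-! ## §1 The gauge between two data with the same `K`-types and the same invariant products -/

/-- **Existence of the gauge** (★ `nonempty_equiv_of_products_eq`, with the gauge exposed).  Two strongly connected data with the same `K`-types, a common
level-minimal vertex `x₀` (no `K`-type at `(x₀.1−1, x₀.2∓3)`), square-complete `K`-type set and the same invariant products `A_{n,m}D_{n+1,m+3}`, `B_{n,m}C_{n+1,m−3}`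
differ by a nowhere-zero gauge `g` along all four arrow families. [cite: Kovacevic2021, §3 Thm 2, Remark 3] -/
theorem exists_gauge_of_products_eq {𝒟₁ 𝒟₂ : SU21Datum} {x₀ : ℤ × ℤ} (hS : 𝒟₁.S = 𝒟₂.S)
    (hconn₁ : ∀ x ∈ 𝒟₁.S, ∀ y ∈ 𝒟₁.S, 𝒟₁.Reach x y) (hconn₂ : ∀ x ∈ 𝒟₂.S, ∀ y ∈ 𝒟₂.S, 𝒟₂.Reach x y)
    (h₀ : x₀ ∈ 𝒟₁.S) (h₀D : (x₀.1 - 1, x₀.2 - 3) ∉ 𝒟₁.S) (h₀C : (x₀.1 - 1, x₀.2 + 3) ∉ 𝒟₁.S)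
    (hsq : ∀ n m : ℤ, (n, m - 3) ∈ 𝒟₁.S → (n, m + 3) ∈ 𝒟₁.S → (n + 1, m) ∈ 𝒟₁.S → (n - 1, m) ∈ 𝒟₁.S)
    (hP : ∀ n m : ℤ, 𝒟₁.A n m * 𝒟₁.D (n + 1) (m + 3) = 𝒟₂.A n m * 𝒟₂.D (n + 1) (m + 3))
    (hQ : ∀ n m : ℤ, 𝒟₁.B n m * 𝒟₁.C (n + 1) (m - 3) = 𝒟₂.B n m * 𝒟₂.C (n + 1) (m - 3)) :
    ∃ g : ℤ → ℤ → ℂ, (∀ n m : ℤ, (n, m) ∈ 𝒟₁.S → g n m ≠ 0) ∧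
      (∀ n m : ℤ, (n + 1, m + 3) ∈ 𝒟₁.S → 𝒟₁.A n m * g (n + 1) (m + 3) = g n m * 𝒟₂.A n m) ∧
      (∀ n m : ℤ, (n + 1, m - 3) ∈ 𝒟₁.S → 𝒟₁.B n m * g (n + 1) (m - 3) = g n m * 𝒟₂.B n m) ∧
      (∀ n m : ℤ, (n - 1, m + 3) ∈ 𝒟₁.S → 𝒟₁.C n m * g (n - 1) (m + 3) = g n m * 𝒟₂.C n m) ∧
      (∀ n m : ℤ, (n - 1, m - 3) ∈ 𝒟₁.S → 𝒟₁.D n m * g (n - 1) (m - 3) = g n m * 𝒟₂.D n m) := by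
  -- adapted from ★ `nonempty_equiv_of_products_eq` (same gauge `levelGauge`, same transport from levels `N : ℕ` to `n : ℤ`)
  let g : ℤ → ℤ → ℂ := fun n m => levelGauge 𝒟₁ 𝒟₂ x₀ n.toNat m
  have step := fun N => levelGauge_step hS hconn₁ hconn₂ h₀ h₀D h₀C hsq N
  have cast : ∀ n m : ℤ, (n, m) ∈ 𝒟₁.S → ∃ N : ℕ, (n : ℤ) = N := fun n m h =>
    ⟨n.toNat, (Int.toNat_of_nonneg (by have := 𝒟₁.one_le_of_mem h; omega)).symm⟩
  have hg : ∀ n m : ℤ, (n, m) ∈ 𝒟₁.S → g n m ≠ 0 := by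
    intro n m h
    obtain ⟨N, rfl⟩ := cast n m h
    simpa [g] using (step N).1 m h
  have hA : ∀ n m : ℤ, (n + 1, m + 3) ∈ 𝒟₁.S → 𝒟₁.A n m * g (n + 1) (m + 3) = g n m * 𝒟₂.A n m := by
    intro n m hy
    by_cases hx : (n, m) ∈ 𝒟₁.S
    · obtain ⟨N, rfl⟩ := cast n m hx
      have := (step N).2.1 (m + 3) (by simpa using hx) hy
      have ht : ((N : ℤ) + 1).toNat = N + 1 := by
        rw [show ((N : ℤ) + 1) = ((N + 1 : ℕ) : ℤ) by norm_cast, Int.toNat_natCast]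
      simpa [g, ht] using this
    · rw [𝒟₁.A_eq_zero hx, 𝒟₂.A_eq_zero (by rwa [← hS]), zero_mul, mul_zero]
  have hB : ∀ n m : ℤ, (n + 1, m - 3) ∈ 𝒟₁.S → 𝒟₁.B n m * g (n + 1) (m - 3) = g n m * 𝒟₂.B n m := by
    intro n m hy
    by_cases hx : (n, m) ∈ 𝒟₁.S
    · obtain ⟨N, rfl⟩ := cast n m hx
      have := (step N).2.2 (m - 3) (by simpa using hx) hy
      have ht : ((N : ℤ) + 1).toNat = N + 1 := by
        rw [show ((N : ℤ) + 1) = ((N + 1 : ℕ) : ℤ) by norm_cast, Int.toNat_natCast]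
      simpa [g, ht] using this
    · rw [𝒟₁.B_eq_zero hx, 𝒟₂.B_eq_zero (by rwa [← hS]), zero_mul, mul_zero]
  exact ⟨g, hg, hA, hB, gaugeC_of_gaugeB hS hconn₁ hQ hB, gaugeD_of_gaugeA hS hconn₁ hP hA⟩

/-! ## §2 Functoriality of the structure of record under a gauge -/

section Gauge

variable {𝒟₁ 𝒟₂ : SU21Datum}

/-- The gauge map on the `K`-type basis of record: `u^k_{n,m} ↦ g_{n,m} u^k_{n,m}` (★ `gaugeMap_vec`; `kvec 𝒟.S = 𝒟.vec` definitionally).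
[cite: Kovacevic2021, §3 Remark 3] -/
theorem gaugeMap_kvec (hS : 𝒟₁.S = 𝒟₂.S) (g : ℤ → ℤ → ℂ) (n m k : ℤ) :
    gaugeMap 𝒟₁ 𝒟₂ g (kvec 𝒟₁.S n m k) = g n m • kvec 𝒟₂.S n m k :=
  gaugeMap_vec hS g n m k

/-- The gauge map commutes with the image of a basis vector under `K` (twisted): inside the `K`-type `V_{n,m}` the group acts by the matrix `kTypeMatTw e n m γ`,
which is the same for both data, and the gauge is the scalar `g_{n,m}` there. [cite: BorelWallach2000, 0 §2.5; VI §4 4.7–4.8] [cite: Kovacevic2021, §3 Remark 3] -/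
theorem gaugeMap_kTypeImgTw (hS : 𝒟₁.S = 𝒟₂.S) (g : ℤ → ℤ → ℂ) (e : ℤ) (γ : G21.maximalCompact) {n m k : ℤ}
    (h₁ : (n, m) ∈ 𝒟₁.S ∧ 1 ≤ k ∧ k ≤ n) (h₂ : (n, m) ∈ 𝒟₂.S ∧ 1 ≤ k ∧ k ≤ n) :
    gaugeMap 𝒟₁ 𝒟₂ g (kTypeImgTw 𝒟₁.S e γ ⟨(n, m, k), h₁⟩) = g n m • kTypeImgTw 𝒟₂.S e γ ⟨(n, m, k), h₂⟩ := by
  simp only [kTypeImgTw, map_sum, map_smul, gaugeMap_kvec hS, Finset.smul_sum, smul_smul]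
  exact Finset.sum_congr rfl fun l _ => by rw [mul_comm]

/-- **The gauge map intertwines the twisted `K`-actions of record** `ρKOfRecord 𝒟ᵢ e = kTypeRepTw 𝒟ᵢ.S e`.
[cite: BorelWallach2000, 0 §2.5; VI §4 4.7–4.8] [cite: Kovacevic2021, §3 Remark 3] -/
theorem gaugeMap_ρKOfRecord (hS : 𝒟₁.S = 𝒟₂.S) (g : ℤ → ℤ → ℂ) (e : ℤ) (γ : G21.maximalCompact) (v : 𝒟₁.V) :
    gaugeMap 𝒟₁ 𝒟₂ g (ρKOfRecord 𝒟₁ e γ v) = ρKOfRecord 𝒟₂ e γ (gaugeMap 𝒟₁ 𝒟₂ g v) := by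
  change gaugeMap 𝒟₁ 𝒟₂ g (kTypeEndTw 𝒟₁.S e γ v) = kTypeEndTw 𝒟₂.S e γ (gaugeMap 𝒟₁ 𝒟₂ g v)
  refine Finsupp.induction_linear v ?_ ?_ ?_
  · simp only [map_zero]
  · intro f₁ f₂ hf₁ hf₂
    simp only [map_add, hf₁, hf₂]
  · rintro ⟨⟨n, m, k⟩, h⟩ c
    have h' : (n, m) ∈ 𝒟₂.S ∧ 1 ≤ k ∧ k ≤ n := ⟨hS ▸ h.1, h.2.1, h.2.2⟩
    rw [kTypeEndTw_single, map_smul, gaugeMap_kTypeImgTw hS g e γ h h', ← Finsupp.smul_single_one, map_smul, ← kvec_of_pos h,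
      gaugeMap_kvec hS, kvec_of_pos h', map_smul, map_smul, kTypeEndTw_single, one_smul]

/-- **The gauge map intertwines the central twists of record** `σOfRecord 𝒟ᵢ e = kovLie 𝒟ᵢ.ρ + (e∕3)·tr` (★ `gaugeMap_lie` for the `𝔤𝔩(3,ℂ)`-part, linearity for the
scalar part). [cite: Kovacevic2021, §3 Thm 2, Remark 3] [cite: KnappVogan1995, Prop. 4.120] -/
theorem gaugeMap_σOfRecord (hS : 𝒟₁.S = 𝒟₂.S) (g : ℤ → ℤ → ℂ)
    (hA : ∀ n m : ℤ, (n + 1, m + 3) ∈ 𝒟₁.S → 𝒟₁.A n m * g (n + 1) (m + 3) = g n m * 𝒟₂.A n m)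
    (hB : ∀ n m : ℤ, (n + 1, m - 3) ∈ 𝒟₁.S → 𝒟₁.B n m * g (n + 1) (m - 3) = g n m * 𝒟₂.B n m)
    (hC : ∀ n m : ℤ, (n - 1, m + 3) ∈ 𝒟₁.S → 𝒟₁.C n m * g (n - 1) (m + 3) = g n m * 𝒟₂.C n m)
    (hD : ∀ n m : ℤ, (n - 1, m - 3) ∈ 𝒟₁.S → 𝒟₁.D n m * g (n - 1) (m - 3) = g n m * 𝒟₂.D n m)
    (e : ℤ) (X : G21.lie) (v : 𝒟₁.V) :
    gaugeMap 𝒟₁ 𝒟₂ g (σOfRecord 𝒟₁ e X v) = σOfRecord 𝒟₂ e X (gaugeMap 𝒟₁ 𝒟₂ g v) := by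
  set M : Matrix (Fin 3) (Fin 3) ℂ := Matrix.reindex (finSumFinEquiv : Fin 2 ⊕ Fin 1 ≃ Fin 3) (finSumFinEquiv : Fin 2 ⊕ Fin 1 ≃ Fin 3)
    (X : Matrix (Fin 2 ⊕ Fin 1) (Fin 2 ⊕ Fin 1) ℂ) with hM
  have h1 : σOfRecord 𝒟₁ e X v = ⁅M, v⁆ + traceCharacter ((e : ℂ) / 3) X • v := rfl
  have h2 : σOfRecord 𝒟₂ e X (gaugeMap 𝒟₁ 𝒟₂ g v) = ⁅M, gaugeMap 𝒟₁ 𝒟₂ g v⁆ + traceCharacter ((e : ℂ) / 3) X • gaugeMap 𝒟₁ 𝒟₂ g v := rfl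
  rw [h1, h2, map_add, map_smul, gaugeMap_lie hS g hA hB hC hD]

/-- **A gauge induces a `(𝔤,K)`-equivalence of the structures of record** (★ `gaugeEquiv` as the linear isomorphism; `gaugeMap_ρKOfRecord`, `gaugeMap_σOfRecord`),
at every central weight `e`. [cite: Kovacevic2021, §3 Thm 2, Remark 3] [cite: BorelWallach2000, I §4.3] -/
theorem areGKEquivalent_ofRecord_of_gauge (hS : 𝒟₁.S = 𝒟₂.S) (g : ℤ → ℤ → ℂ) (hg : ∀ n m : ℤ, (n, m) ∈ 𝒟₁.S → g n m ≠ 0)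
    (hA : ∀ n m : ℤ, (n + 1, m + 3) ∈ 𝒟₁.S → 𝒟₁.A n m * g (n + 1) (m + 3) = g n m * 𝒟₂.A n m)
    (hB : ∀ n m : ℤ, (n + 1, m - 3) ∈ 𝒟₁.S → 𝒟₁.B n m * g (n + 1) (m - 3) = g n m * 𝒟₂.B n m)
    (hC : ∀ n m : ℤ, (n - 1, m + 3) ∈ 𝒟₁.S → 𝒟₁.C n m * g (n - 1) (m + 3) = g n m * 𝒟₂.C n m)
    (hD : ∀ n m : ℤ, (n - 1, m - 3) ∈ 𝒟₁.S → 𝒟₁.D n m * g (n - 1) (m - 3) = g n m * 𝒟₂.D n m) (e : ℤ) :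
    AreGKEquivalent (ρKOfRecord 𝒟₁ e) (σOfRecord 𝒟₁ e) (ρKOfRecord 𝒟₂ e) (σOfRecord 𝒟₂ e) :=
  ⟨{ toLinearEquiv := (gaugeEquiv 𝒟₁ 𝒟₂ g hS hg hA hB hC hD).toLinearEquiv
     map_ρK := fun γ v => gaugeMap_ρKOfRecord hS g e γ v
     map_ρ𝔤 := fun X v => gaugeMap_σOfRecord hS g hA hB hC hD e X v }⟩

end Gauge

/-! ## §3 Same `K`-types + same products ⇒ equivalent structures of record -/

/-- **Two strongly connected data with the same `K`-types (a common level-minimal vertex, square-complete) and the same invariant products have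
`(𝔤,K)`-EQUIVALENT structures of record**, at every central weight `e`. [cite: Kovacevic2021, §3 Thm 2, Remark 3] [cite: BorelWallach2000, I §4.3] -/
theorem areGKEquivalent_ofRecord_of_products_eq {𝒟₁ 𝒟₂ : SU21Datum} {x₀ : ℤ × ℤ} (hS : 𝒟₁.S = 𝒟₂.S)
    (hconn₁ : ∀ x ∈ 𝒟₁.S, ∀ y ∈ 𝒟₁.S, 𝒟₁.Reach x y) (hconn₂ : ∀ x ∈ 𝒟₂.S, ∀ y ∈ 𝒟₂.S, 𝒟₂.Reach x y)
    (h₀ : x₀ ∈ 𝒟₁.S) (h₀D : (x₀.1 - 1, x₀.2 - 3) ∉ 𝒟₁.S) (h₀C : (x₀.1 - 1, x₀.2 + 3) ∉ 𝒟₁.S)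
    (hsq : ∀ n m : ℤ, (n, m - 3) ∈ 𝒟₁.S → (n, m + 3) ∈ 𝒟₁.S → (n + 1, m) ∈ 𝒟₁.S → (n - 1, m) ∈ 𝒟₁.S)
    (hP : ∀ n m : ℤ, 𝒟₁.A n m * 𝒟₁.D (n + 1) (m + 3) = 𝒟₂.A n m * 𝒟₂.D (n + 1) (m + 3))
    (hQ : ∀ n m : ℤ, 𝒟₁.B n m * 𝒟₁.C (n + 1) (m - 3) = 𝒟₂.B n m * 𝒟₂.C (n + 1) (m - 3)) (e : ℤ) :
    AreGKEquivalent (ρKOfRecord 𝒟₁ e) (σOfRecord 𝒟₁ e) (ρKOfRecord 𝒟₂ e) (σOfRecord 𝒟₂ e) := by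
  obtain ⟨g, hg, hA, hB, hC, hD⟩ := exists_gauge_of_products_eq hS hconn₁ hconn₂ h₀ h₀D h₀C hsq hP hQ
  exact areGKEquivalent_ofRecord_of_gauge hS g hg hA hB hC hD e

/-! ## §4 Recognition of the classes of record -/

section Regular

variable {a b c : ℤ}

/-- **The record cells have a level-minimal vertex**: `D_φ` at `(p,q) = (0, a−c)` (★ `dsCellDatum_vertex_zero`), `D_φ^±` at `(p,q) = (0,0)` (level `n = 1`).
[cite: Kovacevic2021, §6] [cite: BorelWallach2000, VI §4 4.10] -/
theorem dsCellDatum_frame (h : IsRegularParam a b c) (j : Fin 3) :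
    ∃ x₀ : ℤ × ℤ, x₀ ∈ (dsCellDatum j a b c).S ∧ (x₀.1 - 1, x₀.2 - 3) ∉ (dsCellDatum j a b c).S ∧ (x₀.1 - 1, x₀.2 + 3) ∉ (dsCellDatum j a b c).S := by
  obtain ⟨h1, h2⟩ := id h
  fin_cases j
  · exact ⟨_, (dsCellDatum_vertex_zero h).1, (dsCellDatum_vertex_zero h).2.1, (dsCellDatum_vertex_zero h).2.2.1⟩
  · refine ⟨((1 : ℤ), 2 * tPlus a b c), ((mem_dsCellDatum_S_iff h _ _).2.1).2 ⟨0, 0, le_rfl, le_rfl, by ring, by ring, by omega⟩, ?_, ?_⟩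
    · intro hx
      obtain ⟨p, q, hp, hq, hn, -, -⟩ := ((mem_dsCellDatum_S_iff h _ _).2.1).1 hx
      simp only at hn
      omega
    · intro hx
      obtain ⟨p, q, hp, hq, hn, -, -⟩ := ((mem_dsCellDatum_S_iff h _ _).2.1).1 hx
      simp only at hn
      omega
  · refine ⟨((1 : ℤ), 2 * tMinus a b c), ((mem_dsCellDatum_S_iff h _ _).2.2).2 ⟨0, 0, le_rfl, le_rfl, by ring, by ring, by omega⟩, ?_, ?_⟩
    · intro hx
      obtain ⟨p, q, hp, hq, hn, -, -⟩ := ((mem_dsCellDatum_S_iff h _ _).2.2).1 hx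
      simp only at hn
      omega
    · intro hx
      obtain ⟨p, q, hp, hq, hn, -, -⟩ := ((mem_dsCellDatum_S_iff h _ _).2.2).1 hx
      simp only at hn
      omega

/-- **The `K`-type sets of the record cells are square-complete**: `(n, m−3), (n, m+3), (n+1, m) ∈ S ⇒ (n−1, m) ∈ S` (in cone coordinates the first two are
`(p, q)` and `(p+1, q−1)`, the conclusion is `(p, q−1)`). [cite: Kovacevic2021, §3 Remark 3; §6] -/
theorem dsCellDatum_squareComplete (h : IsRegularParam a b c) (j : Fin 3) (n m : ℤ)
    (hm : (n, m - 3) ∈ (dsCellDatum j a b c).S) (hp : (n, m + 3) ∈ (dsCellDatum j a b c).S) (_hn : (n + 1, m) ∈ (dsCellDatum j a b c).S) :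
    (n - 1, m) ∈ (dsCellDatum j a b c).S := by
  fin_cases j
  · obtain ⟨p₁, q₁, hp₁, hq₁, hn₁, hm₁, hc₁⟩ := ((mem_dsCellDatum_S_iff h n (m - 3)).1).1 hm
    obtain ⟨p₂, q₂, hp₂, hq₂, hn₂, hm₂, hc₂⟩ := ((mem_dsCellDatum_S_iff h n (m + 3)).1).1 hp
    exact ((mem_dsCellDatum_S_iff h (n - 1) m).1).2 ⟨p₁, q₁ - 1, hp₁, by omega, by omega, by omega, by omega⟩
  · obtain ⟨p₁, q₁, hp₁, hq₁, hn₁, hm₁, hc₁⟩ := ((mem_dsCellDatum_S_iff h n (m - 3)).2.1).1 hm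
    obtain ⟨p₂, q₂, hp₂, hq₂, hn₂, hm₂, hc₂⟩ := ((mem_dsCellDatum_S_iff h n (m + 3)).2.1).1 hp
    exact ((mem_dsCellDatum_S_iff h (n - 1) m).2.1).2 ⟨p₁, q₁ - 1, hp₁, by omega, by omega, by omega, by omega⟩
  · obtain ⟨p₁, q₁, hp₁, hq₁, hn₁, hm₁, hc₁⟩ := ((mem_dsCellDatum_S_iff h n (m - 3)).2.2).1 hm
    obtain ⟨p₂, q₂, hp₂, hq₂, hn₂, hm₂, hc₂⟩ := ((mem_dsCellDatum_S_iff h n (m + 3)).2.2).1 hp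
    exact ((mem_dsCellDatum_S_iff h (n - 1) m).2.2).2 ⟨p₁, q₁ - 1, hp₁, by omega, by omega, by omega, by omega⟩

/-- **RECOGNITION ⇒ CLASS EQUALITY (head).**  At a regular parameter, a strongly connected Kovačević datum `𝒟` with the `K`-types of the record cell
`dsCellDatum j a b c` and the same invariant products `A D′`, `B C′` has — for ANY proofs of the `(𝔤,K)`-axioms and of irreducibility of its structure of record at
the central weight `e = centralOf a b c` — the class of record: `GKIrrClass.mk ⟨𝒟.V, ρKOfRecord 𝒟 e, σOfRecord 𝒟 e, _, _⟩ = dsClsOfRecord a b c j`.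
[cite: Kovacevic2021, §3 Thm 2, Remark 3] [cite: Rogawski1990, §12.3 pp. 176–178] [cite: BorelWallach2000, I §4.3] -/
theorem mk_ofRecord_eq_dsClsOfRecord (h : IsRegularParam a b c) (j : Fin 3) {𝒟 : SU21Datum}
    (hconn : ∀ x ∈ 𝒟.S, ∀ y ∈ 𝒟.S, 𝒟.Reach x y) (hS : 𝒟.S = (dsCellDatum j a b c).S)
    (hP : ∀ n m : ℤ, 𝒟.A n m * 𝒟.D (n + 1) (m + 3) = (dsCellDatum j a b c).A n m * (dsCellDatum j a b c).D (n + 1) (m + 3))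
    (hQ : ∀ n m : ℤ, 𝒟.B n m * 𝒟.C (n + 1) (m - 3) = (dsCellDatum j a b c).B n m * (dsCellDatum j a b c).C (n + 1) (m - 3))
    (hGK : IsGKModule G21 (ρKOfRecord 𝒟 (centralOf a b c)) (σOfRecord 𝒟 (centralOf a b c)))
    (hirr : IsIrreducibleGK (ρKOfRecord 𝒟 (centralOf a b c)) (σOfRecord 𝒟 (centralOf a b c))) :
    GKIrrClass.mk ⟨𝒟.V, ρKOfRecord 𝒟 (centralOf a b c), σOfRecord 𝒟 (centralOf a b c), hGK, hirr⟩ = dsClsOfRecord a b c j := by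
  obtain ⟨x₀, h₀, h₀D, h₀C⟩ := dsCellDatum_frame h j
  rw [dsClsOfRecord_of_regular h j, GKIrrClass.mk_eq_mk_iff]
  exact areGKEquivalent_ofRecord_of_products_eq (x₀ := x₀) hS hconn (dsCellDatum_reach h j) (by rw [hS]; exact h₀) (by rw [hS]; exact h₀D)
    (by rw [hS]; exact h₀C) (fun n m h1 h2 h3 => by rw [hS] at h1 h2 h3 ⊢; exact dsCellDatum_squareComplete h j n m h1 h2 h3) hP hQ (centralOf a b c)

/-- **RECOGNITION ⇒ CLASS EQUALITY, irreducible-datum form**: for an IRREDUCIBLE datum (★ `forall_reach_of_isIrreducible` gives strong connectivity; integrality at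
`e = centralOf a b c` comes from the cell, ★ `dsCellDatum_integral`) with the `K`-types and products of the record cell `j`, the structure of record (★ `isGKModule_ofRecord`,
★ `isIrreducibleGK_ofRecord`) has the class `dsClsOfRecord a b c j`. [cite: Kovacevic2021, §3 Thm 2–3, Remark 3] [cite: Rogawski1990, §12.3 pp. 176–178] -/
theorem mk_ofRecord_eq_dsClsOfRecord_of_isIrreducible (h : IsRegularParam a b c) (j : Fin 3) {𝒟 : SU21Datum}
    (hirr : LieModule.IsIrreducible ℂ (Matrix (Fin 3) (Fin 3) ℂ) 𝒟.V) (hS : 𝒟.S = (dsCellDatum j a b c).S)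
    (hP : ∀ n m : ℤ, 𝒟.A n m * 𝒟.D (n + 1) (m + 3) = (dsCellDatum j a b c).A n m * (dsCellDatum j a b c).D (n + 1) (m + 3))
    (hQ : ∀ n m : ℤ, 𝒟.B n m * 𝒟.C (n + 1) (m - 3) = (dsCellDatum j a b c).B n m * (dsCellDatum j a b c).C (n + 1) (m - 3)) :
    GKIrrClass.mk ⟨𝒟.V, ρKOfRecord 𝒟 (centralOf a b c), σOfRecord 𝒟 (centralOf a b c),
        isGKModule_ofRecord 𝒟 (centralOf a b c) (fun _ _ hnm => dsCellDatum_integral h j (hS ▸ hnm)),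
        isIrreducibleGK_ofRecord 𝒟 (centralOf a b c) (fun _ _ hnm => dsCellDatum_integral h j (hS ▸ hnm)) hirr⟩ = dsClsOfRecord a b c j :=
  mk_ofRecord_eq_dsClsOfRecord h j (forall_reach_of_isIrreducible (hirr := hirr)) hS hP hQ _ _

/-- **The `UnitaryDualWith`-shaped corollary**: such a structure of record IS a member of the table of record — `∃ i, GKIrrClass.mk ⟨…⟩ = dsCarriersOfRecord.cls a b c i`.
[cite: Rogawski1990, §12.3 pp. 176–178] [cite: Kovacevic2021, §3 Thm 2, Remark 3] -/
theorem exists_mk_ofRecord_eq_cls (h : IsRegularParam a b c) (j : Fin 3) {𝒟 : SU21Datum}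
    (hconn : ∀ x ∈ 𝒟.S, ∀ y ∈ 𝒟.S, 𝒟.Reach x y) (hS : 𝒟.S = (dsCellDatum j a b c).S)
    (hP : ∀ n m : ℤ, 𝒟.A n m * 𝒟.D (n + 1) (m + 3) = (dsCellDatum j a b c).A n m * (dsCellDatum j a b c).D (n + 1) (m + 3))
    (hQ : ∀ n m : ℤ, 𝒟.B n m * 𝒟.C (n + 1) (m - 3) = (dsCellDatum j a b c).B n m * (dsCellDatum j a b c).C (n + 1) (m - 3))
    (hGK : IsGKModule G21 (ρKOfRecord 𝒟 (centralOf a b c)) (σOfRecord 𝒟 (centralOf a b c)))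
    (hirr : IsIrreducibleGK (ρKOfRecord 𝒟 (centralOf a b c)) (σOfRecord 𝒟 (centralOf a b c))) :
    ∃ i : Fin 3, GKIrrClass.mk ⟨𝒟.V, ρKOfRecord 𝒟 (centralOf a b c), σOfRecord 𝒟 (centralOf a b c), hGK, hirr⟩ = dsCarriersOfRecord.cls a b c i :=
  ⟨j, by rw [dsCarriersOfRecord_cls]; exact mk_ofRecord_eq_dsClsOfRecord h j hconn hS hP hQ hGK hirr⟩

end Regular

end Summit.HodgeConjecture.HodgeConjecture.Cruxes.H413.K2E1bDSRecordRecognition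

end
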